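import Summits.Ventures.PercRepro.ProfileGapMonoReduce
import Summits.Ventures.PercRepro.ProfileGapMonoGeneric

/-!
# PercRepro — THE SHARPENED REDUCTION: the gap-monotonicity rule only has to be checked on simple matroids WITHOUT a
`q`-generic point, or at the `q − 1` levels below the top (p10, gen 7; `proofs/P10-AVFULL.md` §15)

`HardRuleQ α` asks for a gap-monotone point only in a simple matroid `N` on at least `u + q + 1` elements that is
«hard» at `(q, u)`: `ρ(E) < u + q` or no point of `N` is `q`-generic.  `profileIneqMinusQ_of_hardRuleQ` runs the
induction of ProfileGapMonoReduce with one more case — a `q`-generic point `z` of a simple matroid with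
`ρ(E) ≥ u + q` is gap-monotone by `gapMonoQ_of_generic` and the induction hypothesis `(q−1, u−1)` for `M ／ z` — and
`c025_of_hardRuleQ` is `C025` from the hard rule.

* `HardRuleQ`, **`profileIneqMinusQ_of_hardRuleQ`**, `profileIneq_of_hardRuleQ`, `c025Profile_of_hardRuleQ`,
  **`c025_of_hardRuleQ`**.
-/

open scoped Matroid

namespace PercRepro.Cogirth

open Finset ThmH Skew Shadow Profile

variable {α : Type} [DecidableEq α]

/-- **The hard rule**: a gap-monotone point in every simple matroid on at least `u + q + 1` elements that has
`ρ(E) < u + q` or no `q`-generic point. -/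
def HardRuleQ (α : Type) [DecidableEq α] : Prop :=
  ∀ (q u : ℕ), q < u → ∀ (N : Matroid α) [N.Finite], Simple' N → u + q + 1 ≤ (gr N).card →
    (rk N (gr N) < u + q ∨ ∀ z ∈ gr N, ¬ GenericQ N z q) → ∃ z ∈ gr N, GapMonoQ N z q u

/-- **THE SHARPENED REDUCTION**: the hard rule gives the co-rank-`q` row of every finite matroid for every `q < u`. -/
theorem profileIneqMinusQ_of_hardRuleQ_aux (hrule : HardRuleQ α) (n : ℕ) :
    ∀ (K : Matroid α) [K.Finite], (gr K).card = n → ∀ q u : ℕ, q < u → ProfileIneqMinusQ K q u := by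
  induction n using Nat.strong_induction_on with
  | _ n ih =>
    intro K _ hn q u hqu
    rcases Nat.eq_zero_or_pos q with hq0 | hq
    · rw [hq0]
      exact profileIneqMinusQ_zero K u
    by_cases hsmall : (gr K).card ≤ u + q
    · exact profileIneqMinusQ_of_card_le hqu.le hsmall
    push Not at hsmall
    have hIH : ∀ z ∈ gr K, ProfileIneqMinusQ (K ＼ ({z} : Set α)) q u := by
      intro z hz
      have hcard : (gr (K ＼ ({z} : Set α))).card = n - 1 := by
        rw [gr_delete', card_erase_of_mem hz, hn]
      have hlt : n - 1 < n := by
        have := card_pos.2 ⟨z, hz⟩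
        omega
      exact ih (n - 1) hlt _ hcard q u hqu
    by_cases hl : ∃ ℓ ∈ gr K, rk K {ℓ} = 0
    · obtain ⟨ℓ, hℓ, h0⟩ := hl
      exact profileIneqMinusQ_of_gapMonoQ (gapMonoQ_of_loop hℓ h0 (hIH ℓ hℓ)) (hIH ℓ hℓ)
    push Not at hl
    have h1 : ∀ x ∈ gr K, rk K {x} = 1 := by
      intro x hx
      have := rk_le_card (M := K) ({x} : Finset α)
      rw [card_singleton] at this
      have := hl x hx
      omega
    by_cases hp : ∃ z ∈ gr K, ∃ z' ∈ gr K, z ≠ z' ∧ rk K {z, z'} = 1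
    · obtain ⟨z, hz, z', hz', hzz', hpar⟩ := hp
      have hcard : (gr ((K ＼ ({z} : Set α)) ／ ({z'} : Set α))).card = n - 2 := by
        rw [gr_contract', gr_delete', card_erase_of_mem (mem_erase.2 ⟨Ne.symm hzz', hz'⟩), card_erase_of_mem hz, hn]
        omega
      have hlt : n - 2 < n := by
        have := card_pos.2 ⟨z, hz⟩
        omega
      have hdel := ih (n - 2) hlt _ hcard (q - 1) (u - 1) (by omega)
      exact profileIneqMinusQ_of_gapMonoQ
        (gapMonoQ_of_parallel hz hz' hzz' (h1 z hz) (h1 z' hz') hpar hq hqu hdel) (hIH z hz)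
    push Not at hp
    have h2 : ∀ x ∈ gr K, ∀ y ∈ gr K, x ≠ y → rk K {x, y} = 2 := by
      intro x hx y hy hxy
      have hle := rk_le_card (M := K) ({x, y} : Finset α)
      rw [card_pair hxy] at hle
      have hge : rk K {x} ≤ rk K {x, y} := rk_mono_sub (by simp)
      have hne := hp x hx y hy hxy
      have := h1 x hx
      omega
    have hs : Simple' K := simple'_of_rk_one_two h1 h2
    -- a `q`-generic point in the regime `ρ(E) ≥ u + q`
    by_cases hgen : u + q ≤ rk K (gr K) ∧ ∃ z ∈ gr K, GenericQ K z q
    · obtain ⟨hR, z, hz, hg⟩ := hgen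
      have hzI : K.Indep {z} := by
        have h := indep_of_rk_eq_card (M := K) (X := {z}) (by rw [card_singleton]; exact h1 z hz)
        rwa [coe_singleton] at h
      have hcard : (gr (K ／ ({z} : Set α))).card = n - 1 := by
        rw [gr_contract', card_erase_of_mem hz, hn]
      have hlt : n - 1 < n := by
        have := card_pos.2 ⟨z, hz⟩
        omega
      have hdel := ih (n - 1) hlt _ hcard (q - 1) (u - 1) (by omega)
      exact profileIneqMinusQ_of_gapMonoQ (gapMonoQ_of_generic hzI hq hqu hg hR hdel) (hIH z hz)
    -- otherwise the matroid is hard and the rule gives the point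
    have hhard : rk K (gr K) < u + q ∨ ∀ z ∈ gr K, ¬ GenericQ K z q := by
      by_cases hR : u + q ≤ rk K (gr K)
      · right
        intro z hz hg
        exact hgen ⟨hR, z, hz, hg⟩
      · left
        omega
    obtain ⟨z, hz, hgm⟩ := hrule q u hqu K hs (by omega) hhard
    exact profileIneqMinusQ_of_gapMonoQ hgm (hIH z hz)

/-- The co-rank-`q` row of every finite matroid from the hard rule. -/
theorem profileIneqMinusQ_of_hardRuleQ (hrule : HardRuleQ α) (K : Matroid α) [K.Finite] {q u : ℕ}
    (hqu : q < u) : ProfileIneqMinusQ K q u :=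
  profileIneqMinusQ_of_hardRuleQ_aux hrule _ K rfl q u hqu

/-- The plain row from the hard rule. -/
theorem profileIneq_of_hardRuleQ (hrule : HardRuleQ α) (K : Matroid α) [K.Finite] {q u : ℕ}
    (hqu : q < u) : ProfileIneq K q u :=
  profileIneq_of_minusQ hqu.le (profileIneqMinusQ_of_hardRuleQ hrule K hqu)

end PercRepro.Cogirth

namespace PercRepro

/-- **`C025Profile` FROM THE HARD RULE.** -/
theorem c025Profile_of_hardRuleQ (h : ∀ (α : Type) [DecidableEq α], Cogirth.HardRuleQ α) : C025Profile := by
  intro α _ M _ q u hqu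
  exact Cogirth.profileIneq_of_hardRuleQ (h α) M hqu

/-- **`C025` FROM THE HARD RULE**: a gap-monotone point is only needed in simple matroids without a `q`-generic point
or at the `q − 1` levels below the top. -/
theorem c025_of_hardRuleQ (h : ∀ (α : Type) [DecidableEq α], Cogirth.HardRuleQ α) : C025 :=
  c025_of_profile (c025Profile_of_hardRuleQ h)

end PercRepro
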